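import Literature.MathematicalPhysics.QuantumFieldTheory.ConformalBootstrap3D.PointKernelLowerV3M
import Literature.MathematicalPhysics.QuantumFieldTheory.ConformalBootstrap3D.PointKernelLowerSigma

/-!
# σ-form of the LOWER-box kernel theorem, v3 head cells with semantic (M)

`SigmaBoxExcluded Q` (exclusion over the single-correlator class `SatisfiesSigmaAxioms`,
`SingleCorrelatorNonVacuity`) is the conclusion the global enclosure programme
(`IsingEnclosureGlobal.GlobalCertificates`, `GlobalEnclosure.GlobalCertificates17`) consumes.  Exactly as
`PointKernelLowerSigma` did for the two-row table of `PointKernelLowerM`, this file re-derives the last two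
steps of the v3 chain `PCert.boxExcluded_of_kernelV3M → boxExcluded_of_pointCells →
boxExcluded_of_pointRules_twistI` with the final step replaced by `sigmaBoxExcluded_of_pointRules_twistI`;
every hypothesis list is verbatim, so a landed instance `PCert.boxExcluded_of_kernelV3M …` (e.g. the K34L515
assembly `PointKernelK34L515.boxExcluded_K34L515_of_rows`) becomes σ-form by changing the head symbol:

* `sigmaBoxExcluded_of_pointCells` — σ-version of `boxExcluded_of_pointCells` (`PointFunctionalQuadCell`);
* `PCert.sigmaBoxExcluded_of_kernelV3M` — σ-version of `PCert.boxExcluded_of_kernelV3M` (`PointKernelLowerV3M`).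

References: the sum rule and linear-functional method [cite: HogervorstRychkov2013, §3 eq. (3.6)];
single-correlator axioms [cite: KosPolandSimmonsduffin2014, §3.3 eq. (3.16)].  Pure logic over landed theorems.
-/

noncomputable section

namespace Literature.MathematicalPhysics.QuantumFieldTheory.ConformalBootstrap3D

open Real Finset Set

/-! ### The two-row lower table with semantic head cells, σ-version -/

/-- **σ-version of `boxExcluded_of_pointCells`** (two-row LOWER-box table with SEMANTIC head cells): the hypothesis
list verbatim; conclusion `SigmaBoxExcluded Q` (exclusion over the single-correlator class `SatisfiesSigmaAxioms`),
through `sigmaBoxExcluded_of_pointRules_twistI`.  Original docstring: Nodes / apex / domination data as in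
`boxExcluded_of_pointTable₂`; twist gap `τ ≤ 1`, `τ ≤ E₀`; the box `Q ⊆ [s_lo, s_hi] × ([ε_lo, ε_hi)
∪ [t_{0,0}, E₀))`; an `ε`-row `tε 0 = ε_lo, …, tε Kε = ε_hi`, the scalar row `t 0 0 ≤ 3, …,
t 0 (K 0) = E₀` and for every even `0 < ℓ < L` (`E₀ ≤ L + 1`) a row from `ℓ + 1` to `E₀`, every
cell given as BLOCK POSITIVITY on `Q × [cell)` (from `cell_of_headNumber₂` or
`cell_of_headQuadNumber₂_pieces`); (O1) on `Q`; (M) termwise on the twist domain; (T) the apex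
bracket. CONCLUSION (here): `SigmaBoxExcluded Q`. [cite: HogervorstRychkov2013, §3 eq. (3.6)] -/
theorem sigmaBoxExcluded_of_pointCells {N : ℕ} {w z zb : Fin N → ℝ}
    (hz : ∀ k, z k ∈ Ioo (0 : ℝ) 1) (hzb : ∀ k, zb k ∈ Ioo (0 : ℝ) 1) (hord : ∀ k, zb k ≤ z k)
    (apex : Fin N) (hapex : 0 ≤ w apex) (qd qr : Fin N → ℝ) (hqd : ∀ k, 0 < qd k ∧ qd k ≤ 1)
    (hqr : ∀ k, 0 < qr k ∧ qr k ≤ 1)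
    (hdomd : ∀ k, z k * zb k ≤ qd k ^ 2 * (z apex * zb apex) ∧ z k ≤ qd k * z apex)
    (hdomr : ∀ k, (1 - z k) * (1 - zb k) ≤ qr k ^ 2 * (z apex * zb apex) ∧
      1 - zb k ≤ qr k * z apex)
    {Q : Set (ℝ × ℝ)} {slo shi εlo εhi E₀ ET τ : ℝ}
    (t : ℕ → ℕ → ℝ) (K : ℕ → ℕ) (tε : ℕ → ℝ) (Kε : ℕ)
    (hQ : ∀ p ∈ Q, (slo ≤ p.1 ∧ p.1 ≤ shi) ∧
      ((εlo ≤ p.2 ∧ p.2 < εhi) ∨ (t 0 0 ≤ p.2 ∧ p.2 < E₀)))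
    (L : ℕ) (hL : E₀ ≤ (L : ℝ) + 1) (hτ1 : τ ≤ 1) (hτ0 : τ ≤ E₀)
    -- (O1), on `Q` itself
    (hI : ∀ p ∈ Q, 0 < pointFunctional w z zb (crossF p.1 (-1) (fun _ _ => (1 : ℝ))))
    -- the rows
    (htε : tε 0 = εlo ∧ tε Kε = εhi)
    (ht0 : t 0 0 ≤ 3 ∧ t 0 (K 0) = E₀)
    (htℓ : ∀ ℓ, Even ℓ → ℓ ≠ 0 → ℓ < L → t ℓ 0 = (ℓ : ℝ) + 1 ∧ t ℓ (K ℓ) = E₀)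
    (hcellε : ∀ k < Kε, ∀ p ∈ Q,
      ∀ Δ ∈ Ico (tε k) (tε (k + 1)), BlockPositive (pointFunctional w z zb) p.1 Δ 0)
    (hcell : ∀ ℓ, (ℓ = 0 ∨ (Even ℓ ∧ ℓ < L)) → ∀ k < K ℓ, ∀ p ∈ Q,
      ∀ Δ ∈ Ico (t ℓ k) (t ℓ (k + 1)), BlockPositive (pointFunctional w z zb) p.1 Δ ℓ)
    -- (M), termwise
    (hM : ∀ (j : ℕ) (E : ℝ), E₀ ≤ E → E < ET → (j : ℝ) + τ ≤ E → ∀ p ∈ Q,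
      0 ≤ pointFunctional w z zb (crossF p.1 (-1) (zMono E j)))
    -- (T)
    (hB : ∑ k ∈ univ.erase apex, |w k| * ((1 - z k) * (1 - zb k)) ^ slo * qd k ^ ET
          + ∑ k, |w k| * (z k * zb k) ^ slo * qr k ^ ET ≤
          w apex * ((1 - z apex) * (1 - zb apex)) ^ shi) :
    SigmaBoxExcluded Q := by
  have hQ1 : ∀ p ∈ Q, slo ≤ p.1 ∧ p.1 ≤ shi := fun p hp => (hQ p hp).1
  refine sigmaBoxExcluded_of_pointRules_twistI hz hzb hord apex hapex qd qr hqd hqr hdomd hdomr hQ1 hτ1 hτ0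
    hI ?_ ?_ ?_ hM hB
  · -- (O2): `Δ_ε` lies in the ε-row or in the scalar row
    intro p hp
    rcases (hQ p hp).2 with hε | h0
    · exact blockPositive_of_cells_Ico tε Kε hcellε p hp p.2 ⟨htε.1 ▸ hε.1, htε.2 ▸ hε.2⟩
    · exact blockPositive_of_cells_Ico (t 0) (K 0) (hcell 0 (Or.inl rfl)) p hp p.2
        ⟨h0.1, ht0.2 ▸ h0.2⟩
  · -- (O3)
    exact scalar_nonneg_of_cells (t 0) (K 0) ht0.1 ht0.2 (hcell 0 (Or.inl rfl))
  · -- (O4)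
    exact spinning_nonneg_of_cells L hL t K (fun ℓ hev hℓ hℓL => (htℓ ℓ hev hℓ hℓL).1.le)
      (fun ℓ hev hℓ hℓL => (htℓ ℓ hev hℓ hℓL).2)
      (fun ℓ hev hℓ hℓL => hcell ℓ (Or.inr ⟨hev, hℓL⟩))


/-! ### The kernel certificate theorem (v3, semantic (M)), σ-version -/

namespace PointKernel

namespace PCert

variable {c : PCert}

/-- **σ-version of `PCert.boxExcluded_of_kernelV3M`** (the lower-box certificate theorem of the kernel, v3 head
cells, semantic (M)): the hypothesis list verbatim; conclusion `SigmaBoxExcluded`.  As `boxExcluded_of_kernelV3` but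
the termwise region `E ∈ [E₀, E_T)` is a hypothesis `hM` on the box
instead of corner-box tables. [cite: HogervorstRychkov2013, §3 eq. (3.6)] -/
theorem sigmaBoxExcluded_of_kernelV3M (hc : c.checkNodes = true)
    (KI : ℕ) (σI : ℕ → ℚ) (hKI : 0 < KI) (hσI0 : σI 0 = c.slo) (hσIK : σI KI = c.shi)
    (hIrow : ∀ i < KI, ∀ s ∈ Icc ((σI i : ℚ) : ℝ) ((σI (i + 1) : ℚ) : ℝ),
      0 < pointFunctional c.wR c.zR c.zbR (crossF s (-1) (fun _ _ => (1 : ℝ))))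
    (qd qr : List ℚ) (ET : ℕ) (hT : c.tOK qd qr ET = true)
    (εlo εhi E0 τ : ℚ) (L : ℕ) (hτ1 : τ ≤ 1) (hτ0 : τ ≤ E0) (hL : E0 ≤ (L : ℚ) + 1)
    (hM : ∀ (j : ℕ) (E : ℝ), ((E0 : ℚ) : ℝ) ≤ E → E < ((ET : ℕ) : ℝ) → (j : ℝ) + ((τ : ℚ) : ℝ) ≤ E →
      ∀ p ∈ QBoxL c.slo c.shi εlo εhi,
        0 ≤ pointFunctional c.wR c.zR c.zbR (crossF p.1 (-1) (zMono E j)))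
    (t : ℕ → ℕ → ℝ) (K : ℕ → ℕ) (tε : ℕ → ℝ) (Kε : ℕ)
    (htε : tε 0 = ((εlo : ℚ) : ℝ) ∧ tε Kε = ((εhi : ℚ) : ℝ))
    (ht0 : t 0 0 ≤ 3 ∧ t 0 (K 0) = ((E0 : ℚ) : ℝ))
    (htℓ : ∀ ℓ, Even ℓ → ℓ ≠ 0 → ℓ < L → t ℓ 0 = (ℓ : ℝ) + 1 ∧ t ℓ (K ℓ) = ((E0 : ℚ) : ℝ))
    (hcellε : ∀ k < Kε, c.V3Block ((E0 : ℚ) : ℝ) ((τ : ℚ) : ℝ) (tε k) (tε (k + 1)) 0)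
    (hcell : ∀ ℓ, (ℓ = 0 ∨ (Even ℓ ∧ ℓ < L)) → ∀ k < K ℓ,
      c.V3Block ((E0 : ℚ) : ℝ) ((τ : ℚ) : ℝ) (t ℓ k) (t ℓ (k + 1)) ℓ) :
    SigmaBoxExcluded (QBoxL c.slo c.shi εlo εhi) := by
  obtain ⟨hqd, hqr, hdomd, hdomr, hB⟩ := t_hyps hc qd qr ET hT
  have hz := zR_mem hc
  have hzb := zbR_mem hc
  have hord : ∀ k : Fin c.N, c.zbR k ≤ c.zR k := by
    intro k
    have hn := checkNode_of_checkNodes hc k.2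
    simpa [zR, zbR] using (show ((c.zb k : ℚ) : ℝ) ≤ ((c.z k : ℚ) : ℝ) by exact_mod_cast zb_le_z hn)
  have hapex : 0 ≤ c.wR ⟨c.apex, apex_lt hc⟩ := by
    simpa [wR] using (show ((0 : ℚ) : ℝ) ≤ ((c.w c.apex : ℚ) : ℝ) by exact_mod_cast w_apex_nonneg hc)
  have hQ1 : ∀ p ∈ QBoxL c.slo c.shi εlo εhi, ((c.slo : ℚ) : ℝ) ≤ p.1 ∧ p.1 ≤ ((c.shi : ℚ) : ℝ) :=
    fun p hp => hp.1
  -- (O1) from the identity pieces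
  have hI : ∀ p ∈ QBoxL c.slo c.shi εlo εhi,
      0 < pointFunctional c.wR c.zR c.zbR (crossF p.1 (-1) (fun _ _ => (1 : ℝ))) := by
    intro p hp
    obtain ⟨i, hi, hs⟩ := exists_piece_Icc (fun i => ((σI i : ℚ) : ℝ)) KI hKI p.1
      ⟨by simp only [hσI0]; exact hp.1.1, by simp only [hσIK]; exact hp.1.2⟩
    exact hIrow i hi p.1 hs
  -- the tail terms on the whole twist domain: (M) below `E_T`, (T) from `E_T` on
  have htail := tail_nonneg_of_pointRules_twist c.wR c.zR c.zbR hz hzb hord ⟨c.apex, apex_lt hc⟩ hapex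
    (c.qR qd) (c.qR qr) hqd hqr hdomd hdomr hQ1 hM hB
  exact sigmaBoxExcluded_of_pointCells hz hzb hord ⟨c.apex, apex_lt hc⟩ hapex (c.qR qd) (c.qR qr) hqd hqr
    hdomd hdomr t K tε Kε (fun p hp => ⟨hp.1, Or.inl hp.2⟩) L (by exact_mod_cast hL)
    (by exact_mod_cast hτ1) (by exact_mod_cast hτ0) hI htε ht0 htℓ
    (fun k hk p hp Δ hΔ => hcellε k hk _ hQ1 htail p hp Δ hΔ)
    (fun ℓ hℓ k hk p hp Δ hΔ => hcell ℓ hℓ k hk _ hQ1 htail p hp Δ hΔ) hM hB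

end PCert

end PointKernel

end Literature.MathematicalPhysics.QuantumFieldTheory.ConformalBootstrap3D
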